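import Mathlib
import HarnessLib.Audit
import Summits.PneNP.PneNP.Theorems.PstarQuadRank

/-!
# Rank rigidity II: translation types of any rank, products of affine functions, and the parity of the rank (ROUND-24, S4b / memo §10 R7)

FRONTIER range-avoidance ladder, rung F-N3, ROUND 24 (cell `pnp-ideate`, planner memo `r24/CORE-BOUND-NOTES.md` §10 R7 case table;
restricted-model proof complexity — nothing here bears on `P` versus `NP`).  Sequel of `PstarRankRigidity`.

`PstarRankRigidity` proves `g ∈ {0, q}` for a quadratic `g` vanishing on `Z(q)` when `q` has a translation direction and rank `≥ 3`, positive
bias, or rank `≥ 6`.  The R7 case table also needs the LOW-rank translation rows (graph type `λ₃ + λ₁λ₂`, hyperplane type `q` affine), where the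
answer is not `{0, q}` but "every member is a product of two affine functions, hence of polar rank `≤ 2`, hence never a forced chord
(`rank ≥ 4`)".  This file proves exactly that, coordinate-free:

* `linPart` — the linear part of an affine function, as a linear map; `isQuadFn_affine_mul` / `finrank_le_rad_affine_mul`: a product `α·β` of
  affine functions is quadratic with polar form `ℓ_α ⊗ ℓ_β + ℓ_β ⊗ ℓ_α`, whose radical has codimension `≤ 2` (RANK `≤ 2`);
* **`eq_zero_or_eq_or_mul_of_translation`** — if `q (x + r) = q x + 1` for some `r` (ANY rank; this includes every non-constant affine `q`,
  `translation_of_affine`), then a quadratic `g` vanishing on `Z(q)` is `0`, `q`, or a product `α · β` of two affine functions: by the master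
  identity `g = q · ∂_r g`; if `∂_r g` is not constant the cubic obstruction (`PstarQuadRank.polar_eq_of_cubic`) writes `q = u·ℓ + λ`
  (`u, ℓ` linear, `λ` affine, `ℓ` = linear part of `∂_r g`) and then `g = (u + λ)·ℓ` or `λ·(ℓ + 1)`;
* `even_rank` — the polar form of a quadratic function has radical of EVEN codimension (`PstarLagrangian.exists_isotropic` against
  `finrank_add_finrank_orthogonal'`), the parity fact used by the remaining rows (rank-2 flats, the elliptic rank-4 exception).
-/

set_option linter.dupNamespace false -- `Summit.PneNP.PneNP.…`: summit = sub-problem name (D-0017 single-conjunct layout)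

open Finset Module
open Summit.PneNP.PneNP.Theorems.PstarLagrangian (finrank_le_finrank_inf_ker_add_one exists_isotropic)
open Summit.PneNP.PneNP.Theorems.PstarCubeIdeals (deriv IsAffineFn IsQuadFn deriv_apply isAffineFn_deriv eq_mul_deriv_of_hyperplane
  flips_of_affine)
open Summit.PneNP.PneNP.Theorems.PstarQuadRank

namespace Summit.PneNP.PneNP.Theorems.PstarRankRigidityTwo

/-- Every element of `𝔽₂` is `0` or `1`. -/
private theorem zmod2_cases (t : ZMod 2) : t = 0 ∨ t = 1 := by
  revert t; decide

/-- In `𝔽₂`, `x + x = 0`. -/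
private theorem zmod2_add_self (x : ZMod 2) : x + x = 0 := by
  revert x; decide

variable {M : Type*} [AddCommGroup M] [Module (ZMod 2) M]

/-! ## Linear parts and products of affine functions -/

/-- The linear part `x ↦ α x + α 0` of an affine function, as a linear map. -/
def linPart {α : M → ZMod 2} (hα : IsAffineFn α) : M →ₗ[ZMod 2] ZMod 2 where
  toFun x := α x + α 0
  map_add' x w := by rw [hα]; ring
  map_smul' t x := by
    rcases zmod2_cases t with rfl | rfl
    · rw [zero_smul, RingHom.id_apply, zero_smul]; exact zmod2_add_self _
    · rw [one_smul, RingHom.id_apply, one_smul]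

/-- Unfolding `linPart`. -/
theorem linPart_apply {α : M → ZMod 2} (hα : IsAffineFn α) (x : M) : linPart hα x = α x + α 0 := rfl

/-- The symmetric product form `ℓ₁ ⊗ ℓ₂ + ℓ₂ ⊗ ℓ₁` of two linear functionals. -/
def symForm (ℓ₁ ℓ₂ : M →ₗ[ZMod 2] ZMod 2) : LinearMap.BilinForm (ZMod 2) M :=
  LinearMap.mk₂ (ZMod 2) (fun x y => ℓ₁ x * ℓ₂ y + ℓ₁ y * ℓ₂ x)
    (fun x x' y => by simp only [map_add]; ring) (fun t x y => by simp only [map_smul, smul_eq_mul]; ring)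
    (fun x y y' => by simp only [map_add]; ring) (fun t x y => by simp only [map_smul, smul_eq_mul]; ring)

/-- Unfolding `symForm`. -/
theorem symForm_apply (ℓ₁ ℓ₂ : M →ₗ[ZMod 2] ZMod 2) (x y : M) : symForm ℓ₁ ℓ₂ x y = ℓ₁ x * ℓ₂ y + ℓ₁ y * ℓ₂ x := rfl

/-- **A product of two affine functions is quadratic**, with polar form `ℓ_α ⊗ ℓ_β + ℓ_β ⊗ ℓ_α`. -/
theorem affine_mul_polar {α β : M → ZMod 2} (hα : IsAffineFn α) (hβ : IsAffineFn β) (x w : M) :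
    α (x + w) * β (x + w) = α x * β x + α w * β w + α 0 * β 0 + symForm (linPart hα) (linPart hβ) x w := by
  rw [symForm_apply, linPart_apply, linPart_apply, linPart_apply, linPart_apply, hα x w, hβ x w]
  generalize α x = a; generalize α w = a'; generalize α 0 = a₀
  generalize β x = b; generalize β w = b'; generalize β 0 = b₀
  revert a a' a₀ b b' b₀; decide

/-- A product of two affine functions is quadratic. -/
theorem isQuadFn_affine_mul {α β : M → ZMod 2} (hα : IsAffineFn α) (hβ : IsAffineFn β) : IsQuadFn (fun x => α x * β x) :=
  ⟨symForm (linPart hα) (linPart hβ), fun x w => affine_mul_polar hα hβ x w⟩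

/-- **Products of affine functions have rank at most two**: the radical of `ℓ₁ ⊗ ℓ₂ + ℓ₂ ⊗ ℓ₁` contains `ker ℓ₁ ∩ ker ℓ₂`, of codimension `≤ 2`. -/
theorem finrank_le_rad_symForm [FiniteDimensional (ZMod 2) M] (ℓ₁ ℓ₂ : M →ₗ[ZMod 2] ZMod 2) :
    finrank (ZMod 2) M ≤ finrank (ZMod 2) (rad (symForm ℓ₁ ℓ₂)) + 2 := by
  have hsub : (⊤ ⊓ LinearMap.ker ℓ₁) ⊓ LinearMap.ker ℓ₂ ≤ rad (symForm ℓ₁ ℓ₂) := by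
    intro x hx
    simp only [Submodule.mem_inf, Submodule.mem_top, true_and, LinearMap.mem_ker] at hx
    rw [mem_rad]
    intro y
    rw [symForm_apply, hx.1, hx.2, zero_mul, mul_zero, add_zero]
  have h1 := finrank_le_finrank_inf_ker_add_one (⊤ : Submodule (ZMod 2) M) ℓ₁
  have h2 := finrank_le_finrank_inf_ker_add_one (⊤ ⊓ LinearMap.ker ℓ₁) ℓ₂
  have h3 := Submodule.finrank_mono hsub
  rw [finrank_top] at h1
  omega

omit [Module (ZMod 2) M] in
/-- A non-constant affine function has a translation direction. -/
theorem translation_of_affine {q : M → ZMod 2} (hq : IsAffineFn q) {v : M} (hv : q v ≠ q 0) : ∀ x, q (x + v) = q x + 1 :=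
  flips_of_affine hq hv

/-! ## Translation types of any rank -/

/-- **Rank rigidity, translation type, any rank.**  If `q (x + r) = q x + 1` for some `r` (polar form `B`), then a quadratic `g` vanishing on
`Z(q)` is `0`, `q`, or a product of two affine functions. -/
theorem eq_zero_or_eq_or_mul_of_translation {q g : M → ZMod 2} {B : LinearMap.BilinForm (ZMod 2) M}
    (hB : ∀ x w, q (x + w) = q x + q w + q 0 + B x w) {r : M} (hr : ∀ x, q (x + r) = q x + 1) (hg : IsQuadFn g)
    (hZ : ∀ x, q x = 0 → g x = 0) :
    (∀ x, g x = 0) ∨ (∀ x, g x = q x) ∨ ∃ α β : M → ZMod 2, IsAffineFn α ∧ IsAffineFn β ∧ ∀ x, g x = α x * β x := by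
  -- `g = q · m`, `m = ∂_r g` affine
  have hmul : ∀ x, g x = q x * deriv g r x := eq_mul_deriv_of_hyperplane (lam := q) hr hZ
  have hm : IsAffineFn (deriv g r) := isAffineFn_deriv hg r
  set m := deriv g r with hmdef
  by_cases hconst : ∀ x, m x = m 0
  · rcases zmod2_cases (m 0) with h0 | h0
    · left; intro x; rw [hmul x, hconst x, h0, mul_zero]
    · right; left; intro x; rw [hmul x, hconst x, h0, mul_one]
  right; right
  push Not at hconst
  obtain ⟨c, hc⟩ := hconst
  have hc1 : m c + m 0 = 1 := by
    rcases zmod2_cases (m c) with e | e <;> rcases zmod2_cases (m 0) with e' | e' <;> rw [e, e'] at hc ⊢ <;>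
      first | exact absurd rfl hc | decide
  have hqm : IsQuadFn (fun x => q x * m x) := by
    have : (fun x => q x * m x) = g := funext fun x => (hmul x).symm
    rw [this]; exact hg
  -- the cubic obstruction: `B x a = u x · ℓ a + u a · ℓ x` with `u = B(·, c)`, `ℓ = m + m 0`
  have hpol : ∀ x a, B x a = B x c * (m a + m 0) + B a c * (m x + m 0) := polar_eq_of_cubic hB hm hqm hc1
  -- `λ := q + u·ℓ` is affine
  set lam : M → ZMod 2 := fun x => q x + B x c * (m x + m 0) with hlamdef
  have hlam : IsAffineFn lam := by
    intro x w
    simp only [hlamdef]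
    rw [hB x w, hpol x w, hm x w, map_add, LinearMap.add_apply, LinearMap.map_zero, LinearMap.zero_apply]
    generalize q x = Q; generalize q w = Q'; generalize q 0 = Q0
    generalize (B x) c = U; generalize (B w) c = U'
    generalize m x = A; generalize m w = A'; generalize m 0 = A0
    revert Q Q' Q0 U U' A A' A0; decide
  -- the linear functional `ℓ` and the linear `u` are affine functions
  have hℓ : IsAffineFn (fun x => m x + m 0) := by
    intro x w; show m (x + w) + m 0 = (m x + m 0) + (m w + m 0) + (m 0 + m 0)
    rw [hm]; have := zmod2_add_self (m 0); linear_combination -this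
  have hu : IsAffineFn (fun x => B x c) := by
    intro x w; show B (x + w) c = B x c + B w c + B 0 c
    rw [map_add, LinearMap.add_apply, LinearMap.map_zero, LinearMap.zero_apply, add_zero]
  -- the two shapes according to the constant `m 0`
  rcases zmod2_cases (m 0) with h0 | h0
  · -- `m = ℓ`: `g = (u + λ) · ℓ`
    refine ⟨fun x => B x c + lam x, fun x => m x + m 0, hu.add hlam, hℓ, fun x => ?_⟩
    rw [hmul x]
    simp only [hlamdef]
    rw [h0, add_zero]
    generalize q x = Q; generalize (B x) c = U; generalize m x = A
    revert Q U A; decide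
  · -- `m = ℓ + 1`: `g = λ · (ℓ + 1)`
    refine ⟨lam, fun x => m x + m 0 + 1, hlam, ?_, fun x => ?_⟩
    · intro x w; show m (x + w) + m 0 + 1 = (m x + m 0 + 1) + (m w + m 0 + 1) + (m 0 + m 0 + 1); rw [hm]
      have := zmod2_add_self (m 0); have h1 := zmod2_add_self (1 : ZMod 2); linear_combination -this - h1
    · rw [hmul x]
      simp only [hlamdef]
      rw [h0]
      generalize q x = Q; generalize (B x) c = U; generalize m x = A
      revert Q U A; decide

/-! ## The rank is even -/

/-- **The polar form of a quadratic function has radical of even codimension** (over a finite-dimensional `𝔽₂`-module). -/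
theorem even_rank [FiniteDimensional (ZMod 2) M] {q : M → ZMod 2} {B : LinearMap.BilinForm (ZMod 2) M}
    (hB : ∀ x w, q (x + w) = q x + q w + q 0 + B x w) : Even (finrank (ZMod 2) M + finrank (ZMod 2) (rad B)) := by
  have halt : ∀ v ∈ (⊤ : Submodule (ZMod 2) M), B v v = 0 := fun v _ => polar_self hB v
  obtain ⟨N, -, hiso, hdim⟩ := exists_isotropic B ⊤ halt
  -- `⊤ ⊓ B.orthogonal ⊤` is the radical (symmetry)
  have hrad : (⊤ : Submodule (ZMod 2) M) ⊓ B.orthogonal ⊤ = rad B := by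
    ext x
    simp only [Submodule.mem_inf, Submodule.mem_top, true_and, LinearMap.BilinForm.mem_orthogonal_iff, mem_rad]
    constructor
    · intro h y; rw [polar_symm hB]; exact h y trivial
    · intro h y _; show B y x = 0; rw [polar_symm hB]; exact h y
  rw [hrad, finrank_top] at hdim
  -- upper bound: an isotropic `N` has `2 dim N ≤ dim M + dim (N ⊓ ker B) ≤ dim M + dim rad`
  have hle : N ≤ B.orthogonal N := by
    intro x hx
    rw [LinearMap.BilinForm.mem_orthogonal_iff]
    intro y hy
    exact hiso y hy x hx
  have h1 := Submodule.finrank_mono hle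
  have h2 := LinearMap.BilinForm.finrank_add_finrank_orthogonal' (B := B) N
  have h3 : finrank (ZMod 2) ↥(N ⊓ LinearMap.ker B) ≤ finrank (ZMod 2) (LinearMap.ker B) := Submodule.finrank_mono inf_le_right
  have hbe : finrank (ZMod 2) (rad B) = finrank (ZMod 2) (LinearMap.ker B) := rfl
  refine ⟨finrank (ZMod 2) N, ?_⟩
  omega

end Summit.PneNP.PneNP.Theorems.PstarRankRigidityTwo
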